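import Summits.BirchSwinnertonDyer.Rank1Residual.X1.GeneratorCountTamagawa
import Summits.BirchSwinnertonDyer.Rank1Residual.Additive.BudgetFromRelaxedKummerCount
import Summits.BirchSwinnertonDyer.Rank1Residual.Additive.UnramifiedClassesLocal
import Summits.BirchSwinnertonDyer.Rank1Residual.Additive.RationalClassesToLayerZero
import Summits.BirchSwinnertonDyer.Rank1Residual.GaloisImage.PropagatedConditionTopOfNoTorsion
import Literature.NumberTheory.EllipticCurves.LocalKummerMap
import HarnessLib

/-!
# Route M's generator COUNT, III: the anomalous prime's own generator — `GeneratorCountGE W p (#S + 1)`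
# from `p ∣ c_v` on `S` AND the `ℚ_∞`-local condition at `p` for mod-`p` classes (ONE typed local
# lemma), by Poitou–Tate pair counting with the Kummer structure relaxed to ALL of `H¹(ℚ_p, E[p])` at
# `p` (cell `b2b-bsdres`, unit `b2b-bsdres-eisenstein-p1`, gen 15; FILE 3)

HONEST FRAMING (run/shared/lean/b2b/bsd-rank1-residual/, verbatim in every file): the goal of the
cell is to DELETE the COMBINATION-SHAPED residual classes of the Birch–Swinnerton-Dyer formula for
ALL analytic-rank `≤ 1` elliptic curves over `ℚ` — "full BSD formula for every rank `≤ 1` curve in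
class `C`" assembled STRICTLY from published theorems — so that the rank-`≤ 1` remainder becomes
exactly the CONSTRUCTION-SHAPED classes, which are TYPED (missing-input `Prop`s), NOT attempted.
This is not "finishing BSD". Sub-cell `b2b-bsdres-eisenstein-p1` (CLASS-OWNERS row "X1 (r = 0)"):
research route; NO CLAIM BEYOND STATED CLASSES; nothing here changes a label; nothing is booked.
THEOREMS ONLY — no definition, no named fact, no typed input introduced: the one unproved LOCAL
statement enters as an explicit hypothesis `hloc` (§1); the named fact consumed is PUBLISHED
(Poitou–Tate duality for Selmer structures over `ℚ`).

## What and why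

FILES 1–2 (`X1/GeneratorCountLayerZero.lean`, `X1/GeneratorCountTamagawa.lean`) turn route T's
layer-`0` count `B₀ = t₀ + a − 2δ` (X1R0-GAPMAP §14.1) into a theorem for its Tamagawa part `t₀` at
`δ = 0`: `GeneratorCountGE W p #S` from `p ∣ c_v` on `S`. The census (`routeM/routeM15tam.py`) shows
that the M₀ closures of record bind with the anomalous prime's OWN contribution `a ∈ {1, 2}`
(§14.1 (c)–(d): `#ker r_p = #Ẽ(𝔽_p)(p)² = p²`, Greenberg Lemma 3.4). This file adds ONE generator
from `p` (`a ≥ 1`):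

* §1 the hypothesis `hloc`: every class of `H¹(ℚ, E[p])` satisfies the `ℚ_∞`-level local
  condition at the place above `p` (the binder `hT` of n1011's
  `Additive.exists_finset_torsion_selmerInftyPreimage_zero_card_eq` there). TRUE at a good ordinary
  ANOMALOUS prime (§1 records the proof to be formalised: `Ẽ[p]` trivial, `#H¹(ℚ_p, 𝔽_p) = p²` — a
  tree theorem —, the unramified line is a connecting image and the cyclotomic line dies on
  `Gal(ℚ̄_p/ℚ_{p,∞})`, then Greenberg Prop. 2.4), FALSE at a non-anomalous one; every prime of the
  leaf X1 ∩ {r = 0} is anomalous.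
* §2 `exists_addSubgroup_relaxedKummer_atP`: n1011's relaxed-Kummer count
  (`Additive.exists_addSubgroup_relaxedKummer`) with the place `v_p` thrown in at local condition
  `⊤`: a finite `S ≤ H¹(ℚ, E[p])`, `#S ≥ p^{#T₀ + 1}`, Kummer off `T₀ ∪ {v_p}` and at `∞`,
  `H¹_ur + 𝓚_v` on `T₀`, unconstrained at `v_p`. The extra factor `p` is
  `mul_natCard_kummer_le_natCard_top`: `#𝓚_{v_p} = #E(ℚ_p)[p]·p` (tree, Milne I.3.3) and
  `#H¹(ℚ_p, E[p]) = (#E(ℚ_p)[p]·p)²` (tree: Tate's local Euler–Poincaré characteristic, PROVED).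
* §3 `generatorCountGE_of_dvd_localTamagawaNumber_atP`: `p` odd, `p ∤ #E(ℚ)_tors`, `hloc`,
  `p ∣ c_v` on `S` ⟹ **`GeneratorCountGE W p (#S + 1)`** (FILE 2's socket
  `generatorCountGE_of_layerZeroClasses`).
* the leaf consumers with count `#S + 1` (`Leaf.bsdp_of_muZero_of_tamagawaCountAtP`, `…_inter`,
  `Leaf.bsdp_of_muPartAt_of_tamagawaCountAtP`) are in FILE 4 `X1/GeneratorCountAnomalousLeaf.lean`.

HONEST LIMIT (numbers, `HOME/b2b-bsdres-eisenstein-p1/routeM/routeM15tam1.py`): count `t₀ + 1` at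
`δ = 0` members reproduces 69 of the 482 M₀-type closures of the X1 r = 0 census (window 2/15, lane
2/2, `p = 3` beyond the window 58/411, `p ∈ {5,7,13}` 7/54), each now kernel-form modulo the local
hypothesis `hloc` of §1, the typed analytic Newton datum and Poitou–Tate over `ℚ`; `a = 2` (the second
generator at `p` when `E(ℚ_p)[p] ≠ 0`, 177/482) needs the pair count with a squared factor at `v_p`
(the index is `p·#E(ℚ_p)[p]`); the `δ = 1` members (the other 305) need the losses `ker h_0` and
`E(ℚ)[p^∞]/p` counted. Discharging §1 is the successor's first target.

References: [GreenbergLNM1716] §2 Prop. 2.4 (pp. 74–75), §3 p. 88 and Lemma 3.4 (p. 89), §5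
pp. 114–118, p. 137; [MilneADT2006] Ch. I Thm. 2.8, Lemma 3.3, Thm. 4.10; X1R0-GAPMAP §14.1, §22, §24.
-/

noncomputable section

open scoped Classical

open Function Field NumberField IsDedekindDomain WeierstrassCurve
  Literature.NumberTheory.EllipticCurves Literature.NumberTheory.GaloisRepresentations
  Literature.NumberTheory.GaloisCohomology Summit.BirchSwinnertonDyer.Rank1Residual.GaloisImage
open Literature.NumberTheory.GaloisRepresentations.DiscreteGaloisModule (SelmerStructure unramifiedSubgroup)

set_option autoImplicit false

namespace Summit.BirchSwinnertonDyer.Rank1Residual.X1.GeneratorCountAnomalous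

variable {W : WeierstrassCurve ℚ} [W.IsElliptic] {p : ℕ} [hp : Fact p.Prime]

/-! ## §1. The `ℚ_∞`-local condition at `p` for mod-`p` classes (a HYPOTHESIS of §3, not a definition)

Throughout §3 the hypothesis `hloc` reads: for the cyclotomic `ℤ_p`-extension `κ`, the place `v ∋ p`
and every `y ∈ H¹(ℚ, E[p])`, the restriction to `Gal(ℚ̄/ℚ_∞)` of `(E[p] ↪ E[p^∞])_* y` dies in
`H¹(Gal(ℚ̄_v/ℚ_v ℚ_∞), E(ℚ̄_v))`, i.e. `h_0(Ψ y)` lies in the tree's `K_∞`-level local kernel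
`localKerOver p (ker κ) ℚ_v` — exactly the binder `hT` of n1011's
`Additive.exists_finset_torsion_selmerInftyPreimage_zero_card_eq` at the place above `p`. It is
kept as an explicit hypothesis (no `def`, nothing asserted). STATUS: it is the mod-`p` shadow of
Greenberg's Lemma 3.4 (LNM 1716 p. 89: at a good ordinary ANOMALOUS prime `#ker(r_v) = #Ẽ(𝔽_p)(p)²`,
and `H¹(ℚ_p, E)[p] ⊆ ker r_v`, X1R0-GAPMAP §14.1 (d)); it HOLDS when `p` is a good ordinary anomalous
prime of `E` — proof to be formalised: `Ẽ[p]` is the trivial `Gal(ℚ̄_p/ℚ_p)`-module when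
`a_p ≡ 1 (mod p)`; `H¹(ℚ_p, 𝔽_p) = 𝔽_p·u ⊕ 𝔽_p·κ̄` has order `p²` (tree: local Tate duality and the
Euler–Poincaré formula for `ℤ/p`, `localEulerPoincareCharacteristic_trivial_prime_adicCompletion`),
with `u` unramified — the connecting image of `Ẽ(𝔽_p)[p]`, hence `0` in `H¹(ℚ_p, Ẽ[p^∞])` — and `κ̄`
the cyclotomic character mod `p`, trivial on `Gal(ℚ̄_p/ℚ_{p,∞})`; so every class has STRICT image over
`ℚ_{p,∞}`, and strict ⇒ Kummer there by Greenberg Prop. 2.4 (tree named fact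
`Greenberg1999.imKummer_ge_strictCondition_goodOrdinary`, from Coates–Greenberg 1996 Cor. 3.2) — and
it FAILS at a non-anomalous good ordinary prime (`ker r_v = 0`, tree
`Iwasawa.GoodOrdinary.localTowerKerPrimary_zero_eq_bot_of_goodOrdinary_nonAnomalous`). On the leaf
X1 ∩ {r = 0} every `p` is anomalous. -/

/-! ## §2. Pair counting with the Kummer structure relaxed on `T₀` (unramified classes) and at `p`
(everything): `p^{#T₀ + 1}` classes -/

/-- **At the place `v ∋ p`: `p · #𝓚_v ≤ #H¹(ℚ_v, E[p])`** — `#𝓚_v = #E(ℚ_v)[p] · #(ℤ_v/p) =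
#E(ℚ_v)[p]·p` (tree `natCard_kummerSelmerStructure_inr`, Milne ADT I Lemma 3.3) and
`#H¹(ℚ_v, E[p]) = (#E(ℚ_v)[p]·p)²` (tree `GaloisImage.natCard_galoisCohomology_toLocal_torsion_eq_sq`:
Tate's local Euler–Poincaré characteristic, PROVED in the tree). [cite: MilneADT2006, Ch. I Thm. 2.8 and Lemma 3.3] -/
theorem mul_natCard_kummer_le_natCard_top {v : HeightOneSpectrum (𝓞 ℚ)}
    (hv : ((p : ℕ) : 𝓞 ℚ) ∈ v.asIdeal) :
    p * Nat.card (W.kummerSelmerStructure (p : ℤ) (Sum.inr v)) ≤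
      Nat.card (⊤ : AddSubgroup
        (galoisCohomology ((W.torsionGaloisModule (p : ℤ)).toLocal (Sum.inr v : Place ℚ)) 1)) := by
  rw [AddSubgroup.card_top, natCard_galoisCohomology_toLocal_torsion_eq_sq W p v,
    W.natCard_kummerSelmerStructure_inr v hp.out.ne_zero,
    natCard_quot_adicCompletionIntegers_of_prime_mem p hv]
  set t := Nat.card (nsmulAddMonoidHom p :
      (W.baseChange (v.adicCompletion ℚ)).toAffine.Point →+ _).ker with ht
  haveI : Finite (nsmulAddMonoidHom p :
      (W.baseChange (v.adicCompletion ℚ)).toAffine.Point →+ _).ker :=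
    W.finite_ker_nsmul_adicCompletion v hp.out.ne_zero
  have ht1 : 0 < t := Nat.card_pos
  rw [sq]
  exact Nat.mul_le_mul_right _ (Nat.le_mul_of_pos_left p ht1)

/-- **The relaxed-Kummer count with the place above `p` thrown in.** Let `p` be an odd prime, `T₀` a
finite set of places `v ∤ p` of `ℚ` carrying Tamagawa witnesses (an unramified non-Kummer class of
`H¹(ℚ_v, E[p])`), and `v_p` the place above `p`. Then there is a FINITE subgroup `S ≤ H¹(ℚ, E[p])`
with `#S ≥ p^{#T₀ + 1}` all of whose classes are local Kummer classes at every finite place off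
`T₀ ∪ {v_p}` and at infinity, and lie in `H¹_ur + 𝓚_v` at `v ∈ T₀` (NO condition at `v_p`): namely
`S = H¹_𝓖(ℚ, E[p])` for the Kummer structure relaxed by the unramified classes on `T₀` and by
EVERYTHING at `v_p`, counted by n1011's `Additive.finite_and_pow_le_card_selmerGroup_of_kummer_le`
(Wiles/DDT 2.19 pair counting; the extra factor `p` at `v_p` is `mul_natCard_kummer_le_natCard_top`).
Named fact: a Poitou–Tate family over `ℚ` (`inv`); Euler–Poincaré is a tree theorem over `ℚ`
(`GaloisImage.EP.forall_localEulerPoincareCharacteristic_adicCompletion`).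
[cite: GreenbergLNM1716, §5 pp. 114–118] [cite: MilneADT2006, Ch. I Thm. 2.8, Thm. 4.10] -/
theorem exists_addSubgroup_relaxedKummer_atP (hodd : p ≠ 2)
    (inv : LocalInvariants ℚ p) (hperf : inv.IsPerfect) (hsum : inv.SumLocalTermEqZero)
    (hcompl : inv.SelmerComplement)
    (T₀ : Finset (HeightOneSpectrum (𝓞 ℚ))) (hT₀p : ∀ v ∈ T₀, ((p : ℕ) : 𝓞 ℚ) ∉ v.asIdeal)
    (hwit : ∀ v ∈ T₀, ∃ u ∈ unramifiedSubgroup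
        ((W.torsionGaloisModule (p : ℤ)).restrictField (v.adicCompletion ℚ)) 1,
      u ∉ W.kummerLocalConditionAt (p : ℤ) (v.adicCompletion ℚ))
    (vp : HeightOneSpectrum (𝓞 ℚ)) (hvp : ((p : ℕ) : 𝓞 ℚ) ∈ vp.asIdeal) :
    ∃ S : AddSubgroup (galH1Torsion W (p : ℤ)), Finite S ∧ p ^ (T₀.card + 1) ≤ Nat.card S ∧
      ∀ y ∈ S,
        (∀ v ∉ (↑(insert vp T₀) : Set (HeightOneSpectrum (𝓞 ℚ))),
            y ∈ selmerLocalKer W (v.adicCompletion ℚ) (p : ℤ)) ∧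
        (∀ w : InfinitePlace ℚ, y ∈ selmerLocalKer W w.Completion (p : ℤ)) ∧
        ∀ v ∈ T₀, galoisCohomology.res (W.torsionGaloisModule (p : ℤ)) (v.adicCompletion ℚ) 1 y ∈
          unramifiedSubgroup ((W.torsionGaloisModule (p : ℤ)).restrictField (v.adicCompletion ℚ)) 1 ⊔
            W.kummerLocalConditionAt (p : ℤ) (v.adicCompletion ℚ) := by
  haveI : NeZero p := ⟨hp.out.ne_zero⟩
  haveI : Finite (geomTorsion W (p : ℤ)) := finite_geomTorsion_of_neZero W p
  have hEP := EP.forall_localEulerPoincareCharacteristic_adicCompletion ℚ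
  have hvpT₀ : vp ∉ T₀ := fun h ↦ hT₀p vp h hvp
  -- a finite set `T ⊇ T₀ ∪ {vp} ∪ {bad} ∪ {v ∣ p}` of finite places
  have hbadfin : {v : HeightOneSpectrum (𝓞 ℚ) | ¬ W.HasGoodReductionAt v}.Finite := by
    have h := W.eventually_hasGoodReductionAt
    rwa [Filter.eventually_cofinite] at h
  have hp0 : (Ideal.span {((p : ℕ) : 𝓞 ℚ)} : Ideal (𝓞 ℚ)) ≠ 0 := by
    rw [Ne, Ideal.zero_eq_bot, Ideal.span_singleton_eq_bot]
    exact_mod_cast hp.out.ne_zero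
  have hpfin : {v : HeightOneSpectrum (𝓞 ℚ) | ((p : ℕ) : 𝓞 ℚ) ∈ v.asIdeal}.Finite := by
    refine (Ideal.finite_factors hp0).subset fun v hv ↦ ?_
    exact (Ideal.dvd_span_singleton).mpr hv
  set T₁ : Finset (HeightOneSpectrum (𝓞 ℚ)) := insert vp T₀ with hT₁
  obtain ⟨T, hT₁T, hTp, hTbad⟩ : ∃ T : Finset (HeightOneSpectrum (𝓞 ℚ)), T₁ ⊆ T ∧
      (∀ v, ((p : ℕ) : 𝓞 ℚ) ∈ v.asIdeal → v ∈ T) ∧ ∀ v, ¬ W.HasGoodReductionAt v → v ∈ T :=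
    ⟨T₁ ∪ (hbadfin.toFinset ∪ hpfin.toFinset), Finset.subset_union_left,
      fun v hv ↦ Finset.mem_union_right _ (Finset.mem_union_right _ (hpfin.mem_toFinset.mpr hv)),
      fun v hv ↦ Finset.mem_union_right _ (Finset.mem_union_left _ (hbadfin.mem_toFinset.mpr hv))⟩
  have hS : ∀ v ∉ T, ((p : ℕ) : 𝓞 ℚ) ∉ v.asIdeal ∧
      GaloisRep.IsUnramifiedAt v (W.torsionGaloisModule (p : ℤ)) := fun v hv ↦ by
    have hpv : ((p : ℕ) : 𝓞 ℚ) ∉ v.asIdeal := fun h ↦ hv (hTp v h)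
    have hgood : W.HasGoodReductionAt v := by_contra fun h ↦ hv (hTbad v h)
    exact ⟨hpv, X11b.AcSelmer.isUnramifiedAt_torsionGaloisModule W hgood
      (by rw [Int.cast_natCast]; exact hpv)⟩
  have hfs_p : ∀ v : HeightOneSpectrum (𝓞 ℚ), ((p : ℕ) : 𝓞 ℚ) ∈ v.asIdeal →
      (Sum.inr v : Place ℚ) ∈ finSupport T := fun v hv ↦ (inr_mem_finSupport_iff T v).mpr (hTp v hv)
  have hfs_bad : ∀ v : HeightOneSpectrum (𝓞 ℚ), ¬ W.HasGoodReductionAt v →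
      (Sum.inr v : Place ℚ) ∈ finSupport T := fun v hv ↦ (inr_mem_finSupport_iff T v).mpr (hTbad v hv)
  have h𝓚 : (W.kummerSelmerStructure (p : ℤ)).IsUnramifiedOutside (finSupport T) := by
    have h1 := X11b.KummerDuality.kummerSelmerStructure_isUnramifiedOutside W p 1
      (finSupport T) (inl_mem_finSupport T) hfs_p hfs_bad
    rwa [pow_one] at h1
  -- the relaxed structure `𝓖`: `⊤` at `vp`, `H¹_ur + 𝓚_v` on `T₀`, `𝓚_v` elsewhere
  obtain ⟨𝓖, h𝓖inl, h𝓖vp, h𝓖T₀, h𝓖off⟩ : ∃ 𝓖 : SelmerStructure (W.torsionGaloisModule (p : ℤ)),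
      (∀ w : InfinitePlace ℚ, 𝓖 (Sum.inl w) = W.kummerSelmerStructure (p : ℤ) (Sum.inl w)) ∧
      𝓖 (Sum.inr vp) = ⊤ ∧
      (∀ v ∈ T₀, 𝓖 (Sum.inr v) =
        unramifiedSubgroup (GaloisRep.toLocal v (W.torsionGaloisModule (p : ℤ))) 1 ⊔
          W.kummerSelmerStructure (p : ℤ) (Sum.inr v)) ∧
      (∀ v ∉ T₁, 𝓖 (Sum.inr v) = W.kummerSelmerStructure (p : ℤ) (Sum.inr v)) := by
    refine ⟨fun w ↦ match w with
      | Sum.inl w => W.kummerSelmerStructure (p : ℤ) (Sum.inl w)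
      | Sum.inr v => if v = vp then ⊤ else if v ∈ T₀ then
          unramifiedSubgroup (GaloisRep.toLocal v (W.torsionGaloisModule (p : ℤ))) 1 ⊔
            W.kummerSelmerStructure (p : ℤ) (Sum.inr v)
        else W.kummerSelmerStructure (p : ℤ) (Sum.inr v),
      fun _ ↦ rfl, if_pos rfl, fun v hv ↦ ?_, fun v hv ↦ ?_⟩
    · have hne : v ≠ vp := fun h ↦ hvpT₀ (h ▸ hv)
      exact (if_neg hne).trans (if_pos hv)
    · have hne : v ≠ vp := fun h ↦ hv (h ▸ Finset.mem_insert_self vp T₀)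
      have hv' : v ∉ T₀ := fun h ↦ hv (Finset.mem_insert_of_mem h)
      exact (if_neg hne).trans (if_neg hv')
  have hle : W.kummerSelmerStructure (p : ℤ) ≤ 𝓖 := by
    rintro (w | v)
    · rw [h𝓖inl w]
    · by_cases hv : v = vp
      · subst hv; rw [h𝓖vp]; exact le_top
      by_cases hv' : v ∈ T₀
      · rw [h𝓖T₀ v hv']; exact le_sup_right
      · rw [h𝓖off v (by
          rw [Finset.mem_insert, not_or]; exact ⟨hv, hv'⟩)]
  have h𝓖ur : 𝓖.IsUnramifiedOutside (finSupport T) := by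
    refine ⟨inl_mem_finSupport T, fun v hv ↦ ?_⟩
    have hvT : v ∉ T := fun h ↦ hv ((inr_mem_finSupport_iff T v).mpr h)
    rw [h𝓖off v fun h ↦ hvT (hT₁T h)]
    exact h𝓚.2 v hv
  have hbig : ∀ v ∈ T₁, p * Nat.card (W.kummerSelmerStructure (p : ℤ) (Sum.inr v)) ≤
      Nat.card (𝓖 (Sum.inr v)) := fun v hv ↦ by
    rcases Finset.mem_insert.mp hv with rfl | hv
    · rw [h𝓖vp]
      exact mul_natCard_kummer_le_natCard_top hvp
    · haveI := finite_galoisCohomology_one_toLocal (W.torsionGaloisModule (p : ℤ)) v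
      obtain ⟨u, hu, huK⟩ := hwit v hv
      refine Additive.mul_card_le_card_of_lt
        (Additive.smul_galoisCohomology_toLocal_torsion_eq_zero W p v) ?_
      rw [h𝓖T₀ v hv]
      exact right_lt_sup.mpr fun h ↦ huK (h hu)
  obtain ⟨hfin, hcard⟩ := Additive.finite_and_pow_le_card_selmerGroup_of_kummer_le W p hodd inv
    hperf hsum hcompl hEP T hS h𝓚 hle h𝓖ur (fun w ↦ (h𝓖inl w).symm) T₁ hT₁T hbig
  have hcardT₁ : T₁.card = T₀.card + 1 := Finset.card_insert_of_notMem hvpT₀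
  refine ⟨𝓖.selmerGroup, hfin, hcardT₁ ▸ hcard, fun y hy ↦ ⟨fun v hv ↦ ?_, fun w ↦ ?_, fun v hv ↦ ?_⟩⟩
  · have hv' : v ∉ T₁ := by rwa [hT₁, ← Finset.mem_coe]
    have h := (𝓖.mem_selmerGroup_iff y).mp hy (Sum.inr v)
    rw [h𝓖off v hv'] at h
    have h' : y ∈ (W.kummerSelmerStructure (p : ℤ) (Sum.inr v)).comap
        (galoisCohomology.localization (W.torsionGaloisModule (p : ℤ)) (Sum.inr v) 1) := h
    rw [comap_localization_kummerSelmerStructure] at h'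
    exact h'
  · have h := (𝓖.mem_selmerGroup_iff y).mp hy (Sum.inl w)
    rw [h𝓖inl w] at h
    have h' : y ∈ (W.kummerSelmerStructure (p : ℤ) (Sum.inl w)).comap
        (galoisCohomology.localization (W.torsionGaloisModule (p : ℤ)) (Sum.inl w) 1) := h
    rw [comap_localization_kummerSelmerStructure] at h'
    exact h'
  · have h := (𝓖.mem_selmerGroup_iff y).mp hy (Sum.inr v)
    rw [h𝓖T₀ v hv] at h
    exact h

/-! ## §3. `GeneratorCountGE W p (#S + 1)` from `p ∣ c_v` on `S` and the local condition at `p` -/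

section Count

open Summit.BirchSwinnertonDyer.Rank1Residual.X1.GeneratorCountSqueeze
  Summit.BirchSwinnertonDyer.Rank1Residual.X1.GeneratorCountTamagawa

variable [W.IsGloballyMinimal]

omit [W.IsGloballyMinimal] in
/-- **`p^{#T₀ + 1}` classes of `A_0[p]`** for every cyclotomic `κ`, when `E(ℚ)[p] = 0`, `p` is odd,
`T₀` carries Tamagawa witnesses, and the `ℚ_∞`-local condition at `p` holds for mod-`p` classes
(`hloc`): §2's subgroup `S` transported by n1011's
`Additive.exists_finset_torsion_selmerInftyPreimage_zero_card_eq`, the `K_∞`-condition on `T₀` being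
n1011's FILE 3b (unramified classes die up the cyclotomic tower) and at `v_p` the typed input.
[cite: GreenbergLNM1716, §3 pp. 85–89 and §5 pp. 114–118] -/
theorem exists_finset_layerZero_of_tamagawaWitnesses_atP (hodd : p ≠ 2)
    (hK : ∀ P : W.toAffine.Point, p • P = 0 → P = 0)
    (inv : LocalInvariants ℚ p) (hperf : inv.IsPerfect) (hsum : inv.SumLocalTermEqZero)
    (hcompl : inv.SelmerComplement)
    (T₀ : Finset (HeightOneSpectrum (𝓞 ℚ))) (hT₀p : ∀ v ∈ T₀, ((p : ℕ) : 𝓞 ℚ) ∉ v.asIdeal)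
    (hwit : ∀ v ∈ T₀, ∃ u ∈ unramifiedSubgroup
        ((W.torsionGaloisModule (p : ℤ)).restrictField (v.adicCompletion ℚ)) 1,
      u ∉ W.kummerLocalConditionAt (p : ℤ) (v.adicCompletion ℚ))
    (vp : HeightOneSpectrum (𝓞 ℚ)) (hvp : ((p : ℕ) : 𝓞 ℚ) ∈ vp.asIdeal)
    (κ : ZpExtension ℚ p) (hκ : κ.IsCyclotomic)
    (hloc : ∀ y : galH1Torsion W (p : ℤ),
      W.layerToInfty κ 0 (resH1Hom (Literature.NumberTheory.EllipticCurves.subgroupIncl (κ.layerSubgroup 0))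
          (AddMonoidHom.id (geomPrimaryTorsion W p)) (fun _ _ ↦ rfl) (torsionToPrimaryH1 W p y)) ∈
        W.localKerOver p κ.kerSubgroup (vp.adicCompletion ℚ)) :
    ∃ s : Finset {z : W.selmerInftyPreimage κ 0 // p • z = 0}, p ^ (T₀.card + 1) ≤ s.card := by
  obtain ⟨S, hSfin, hcard, hS⟩ :=
    exists_addSubgroup_relaxedKummer_atP hodd inv hperf hsum hcompl T₀ hT₀p hwit vp hvp
  haveI := hSfin
  obtain ⟨s, hs⟩ := Additive.exists_finset_torsion_selmerInftyPreimage_zero_card_eq W p κ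
    (fun P hP ↦ hK P (by convert hP)) S
    (↑(insert vp T₀) : Set (HeightOneSpectrum (𝓞 ℚ))) (fun y hy v hv ↦ (hS y hy).1 v hv)
    (fun y hy w ↦ (hS y hy).2.1 w) fun y hy v hv ↦ by
      rcases Finset.mem_insert.mp (Finset.mem_coe.mp hv) with rfl | hv
      · exact hloc y
      · exact Additive.layerToInfty_resH1Hom_torsionToPrimaryH1_mem_localKerOver_of_mem_unramified_sup_kummer
          W p κ v (hT₀p v hv) (Additive.exists_apply_resGal_ne_one_of_isCyclotomic κ hκ v (hT₀p v hv)) y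
          ((hS y hy).2.2 v hv)
  exact ⟨s, hs ▸ hcard⟩

/-- **`GeneratorCountGE W p (#T₀ + 1)` from Tamagawa witnesses and the local condition at `p`.**
`p` odd, `p ∤ #E(ℚ)_tors`; named fact: Poitou–Tate duality for Selmer structures over `ℚ` (`hPT`);
hypothesis `hloc` (§1). [cite: GreenbergLNM1716, §3 Lemma 3.4, §5 pp. 114–118, p. 137] -/
theorem generatorCountGE_of_tamagawaWitnesses_atP (hodd : p ≠ 2)
    (hPT : poitouTate_selmerStructure_duality ℚ) (htors : ¬ p ∣ W.torsionOrder)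
    (hloc : ∀ (κ : ZpExtension ℚ p), κ.IsCyclotomic → ∀ (v : HeightOneSpectrum (𝓞 ℚ)),
      ((p : ℕ) : 𝓞 ℚ) ∈ v.asIdeal → ∀ y : galH1Torsion W (p : ℤ),
      W.layerToInfty κ 0 (resH1Hom (Literature.NumberTheory.EllipticCurves.subgroupIncl (κ.layerSubgroup 0))
          (AddMonoidHom.id (geomPrimaryTorsion W p)) (fun _ _ ↦ rfl) (torsionToPrimaryH1 W p y)) ∈
        W.localKerOver p κ.kerSubgroup (v.adicCompletion ℚ))
    (T₀ : Finset (HeightOneSpectrum (𝓞 ℚ))) (hT₀p : ∀ v ∈ T₀, ((p : ℕ) : 𝓞 ℚ) ∉ v.asIdeal)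
    (hwit : ∀ v ∈ T₀, ∃ u ∈ unramifiedSubgroup
        ((W.torsionGaloisModule (p : ℤ)).restrictField (v.adicCompletion ℚ)) 1,
      u ∉ W.kummerLocalConditionAt (p : ℤ) (v.adicCompletion ℚ))
    (vp : HeightOneSpectrum (𝓞 ℚ)) (hvp : ((p : ℕ) : 𝓞 ℚ) ∈ vp.asIdeal) :
    GeneratorCountGE W p (T₀.card + 1) := by
  haveI : NeZero p := ⟨hp.out.ne_zero⟩
  obtain ⟨inv, hperf, hsum, -, hcompl⟩ := hPT p
  have hK : ∀ P : W.toAffine.Point, p • P = 0 → P = 0 :=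
    fun P hP ↦ Additive.forall_smul_eq_zero_of_not_dvd_torsionOrder W p htors P (by convert hP)
  exact generatorCountGE_of_layerZeroClasses hK fun κ hκ ↦
    exists_finset_layerZero_of_tamagawaWitnesses_atP hodd
      (fun P hP ↦ Additive.forall_smul_eq_zero_of_not_dvd_torsionOrder W p htors P (by convert hP))
      inv hperf hsum hcompl T₀ hT₀p hwit vp hvp κ hκ (hloc κ hκ vp hvp)

/-- **`GeneratorCountGE W p (#S + 1)` from `p ∣ c_v` on `S` and the local condition at `p`** — route
T's layer-`0` count `B₀ = t₀ + a − 2δ` (X1R0-GAPMAP §14.1) at `δ = 0` with `a` replaced by `1`, IN THE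
KERNEL modulo Poitou–Tate over `ℚ` and the ONE local hypothesis `hloc` of §1.
[cite: GreenbergLNM1716, §3 p. 88 and Lemma 3.4 (p. 89), §5 pp. 114–118, p. 137] -/
theorem generatorCountGE_of_dvd_localTamagawaNumber_atP (hodd : p ≠ 2)
    (hPT : poitouTate_selmerStructure_duality ℚ) (htors : ¬ p ∣ W.torsionOrder)
    (hloc : ∀ (κ : ZpExtension ℚ p), κ.IsCyclotomic → ∀ (v : HeightOneSpectrum (𝓞 ℚ)),
      ((p : ℕ) : 𝓞 ℚ) ∈ v.asIdeal → ∀ y : galH1Torsion W (p : ℤ),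
      W.layerToInfty κ 0 (resH1Hom (Literature.NumberTheory.EllipticCurves.subgroupIncl (κ.layerSubgroup 0))
          (AddMonoidHom.id (geomPrimaryTorsion W p)) (fun _ _ ↦ rfl) (torsionToPrimaryH1 W p y)) ∈
        W.localKerOver p κ.kerSubgroup (v.adicCompletion ℚ)) (S : Finset (HeightOneSpectrum (𝓞 ℚ)))
    (hSp : ∀ v ∈ S, ((p : ℕ) : 𝓞 ℚ) ∉ v.asIdeal)
    (hcv : ∀ v ∈ S,
      p ∣ (W.baseChange (v.adicCompletion ℚ)).localTamagawaNumber (v.adicCompletionIntegers ℚ))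
    (vp : HeightOneSpectrum (𝓞 ℚ)) (hvp : ((p : ℕ) : 𝓞 ℚ) ∈ vp.asIdeal) :
    GeneratorCountGE W p (S.card + 1) :=
  generatorCountGE_of_tamagawaWitnesses_atP hodd hPT htors hloc S hSp (fun v hv ↦ by
    haveI : Finite (IsLocalRing.ResidueField (v.adicCompletionIntegers ℚ)) :=
      HeightOneSpectrum.finite_residueField_adicCompletionIntegers ℚ v
    rcases Additive.hasAdditiveReductionAt_or_hasSplitMultiplicativeReductionAt_of_dvd_localTamagawaNumber
        W v hodd (hcv v hv) with hadd | hsplit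
    · exact Additive.exists_mem_unramifiedSubgroup_not_mem_kummerLocalConditionAt_of_hasAdditiveReductionAt
        W p v (hSp v hv) hodd hadd (hcv v hv)
    · exact Additive.exists_mem_unramifiedSubgroup_not_mem_kummerLocalConditionAt_of_split_of_dvd_localTamagawaNumber
        W v hsplit (hSp v hv) (hcv v hv)) vp hvp

end Count

end Summit.BirchSwinnertonDyer.Rank1Residual.X1.GeneratorCountAnomalous

end
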